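import Summits.CriticalPhenomena.Ising3D.Control2DBoxCells
import Summits.CriticalPhenomena.Ising3D.Control2DL11OpeUAData10
import Summits.CriticalPhenomena.Ising3D.Control2DL11OpeUAData11
import Summits.CriticalPhenomena.Ising3D.Control2DL11OpeUAData8
import Summits.CriticalPhenomena.Ising3D.Control2DL11OpeUAData9
import Summits.CriticalPhenomena.Ising3D.Control2DOpeCells
import Mathlib.Tactic.IntervalCases
import Mathlib.Tactic.Linarith
import Mathlib.Tactic.NormNum
import HarnessLib

/-!
# A kind-`ope2` (sense upper) 2D γ-certificate in the kernel: `p_T < 156383/10000000` at `Δ_σ = 1/8` under `A2D′` (Λ = 11)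
(cell `pub-ising3x`, seat controls-1 gen 20; KERNEL PATH for the 2D γ-certificates, kind `ope2` — CONTROL-ONLY)

HONEST FRAMING: lottery ticket; floor = tightest certified 3D Ising CFT bounds; no exact-solution
claim without a proof. CONTROL-ONLY: `d = 2`, global blocks, `Δ_σ = 1/8` exact, the 2D axiom set `A2D′` with the
CERTIFIED `ε` box `[49/50, 20001/20000]` as scalar input (scalars in the box `∪ [2, ∞)`, stress tensor at `(2,2)` + spin-2 gap `1`,
unitarity); nothing about `d = 3`.

**`opeUpper_2d_L11_opeUA : OpeUpperA2D (1/8) 2 1 (49 / 50) (20001 / 20000) (156383/10000000)`** — the total `(2,2)` coefficient obeys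
`p_T < 156383/10000000` (by the Virasoro Ward identity `p_T = Δ_σ²/(2c)`: `c > 0.4995748`; cf. the HYPOTHESIS `hhi` of
`cTwoSided_rb6_L11` in `Control2DOpeTwoSided`, which this theorem discharges) — from the RB-6 ope2 (sense upper) certificate `j136827_functional_deriv2d_L11_E032_sig1o8_ope2upper_P156383o10000000.json` (Λ = 11, E₀ = 32): p_T < 156383/10000000 at Δ_σ = 1/8 under A2D′ with the ε box [49/50, 20001/20000] (⇒ c > (1/8)²/(2·156383/10000000) = 0.4995748 by the Ward identity), with EVERY obligation re-decided
in the Lean kernel: (I′) and the `T` value as integer inequalities on `identZ`, the head of the spin-2 cell literal and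
`denProdNat` (`opeUpper_half_of_cellsZ`, `Control2DOpeCells`), (R) `region_opeUA`, cells `cells_opeUA`
(one integer polynomial per spin from the literal library, Bernstein leaves). Zero grant compute. No facts, standard axioms only.

`cells_opeUA`: every cell obligation of the certificate ((E) on the ε box, (C′) scalars on [2, E₀), the stress-tensor point (T), spin 2 on [3, E₀), even spins ≥ 4 on [ℓ, E₀); E₀ = 32), in the witness form `∃ N ≥ E₀` with the spin's own truncation
order, from the kernel-decided Bernstein leaves of `Control2DL11OpeUAData*` via `cell_nonneg_of_bernCheck`. No facts, standard axioms only.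

ONE MODULE for the cells theorem and the assembly (controls-1 g20): every gate dependency level waits for the farm's tree build to catch
up with the freshly landed imports (measured 1–2 h per level under load, `remote:stale:…:unbuilt`), so the cells theorem below is not a
separate `…Cells` module as in the earlier replays; statements and proofs are unchanged.
-/

namespace Summit.CriticalPhenomena.Ising3D.Control2D

open Finset Set
open Literature.MathematicalPhysics.QuantumFieldTheory.ConformalBootstrap3D

set_option maxHeartbeats 0 in
set_option maxRecDepth 200000 in
/-- **The cells of the certificate** (p_T < 156383/10000000 at Δ_σ = 1/8 under A2D′ with the ε box [49/50, 20001/20000] (⇒ c > (1/8)²/(2·156383/10000000) = 0.4995748 by the Ward identity); `E₀ = 32`; truncation `N = Nd + 1` per spin: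
ℓ=0: 48, ℓ=2: 48, ℓ=4: 48, ℓ=6: 40, ℓ=8: 40, ℓ=10: 40, ℓ=12: 40 ; others `N = 32`). [folklore] -/
theorem cells_opeUA :
    BoxCellsN slL11.toFinset (fun p => (wtopeUA p : ℝ)) (1 / 8) 2 1 (49 / 50) (20001 / 20000) 32 := by
  refine ⟨?_, ?_, ?_, ?_, ?_⟩
  · intro Δ h1 h2
    refine ⟨47 + 1, by norm_num, ?_⟩
    exact cell_nonneg_of_bernAuto_trunc wtopeUA slL11_nodup slL11_deg 0 47 284 (q := 40000) (a := 19600) (L := 401) (by norm_num) (by norm_num) (by norm_num) (by rw [phatopeUAs0_eq]; exact cellChk_opeUA_s0l0) (by norm_num; linarith) (by norm_num; linarith)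
  · intro Δ h1 h2
    replace h2 := h2.le
    refine ⟨47 + 1, by norm_num, ?_⟩
    rcases le_or_gt Δ ((31 : ℝ) / 8) with hd0 | hd0
    · exact cell_nonneg_of_bernAuto_trunc wtopeUA slL11_nodup slL11_deg 0 47 284 (q := 16) (a := 16) (L := 15) (by norm_num) (by norm_num) (by norm_num) (by rw [phatopeUAs0_eq]; exact cellChk_opeUA_s0l1) (by norm_num; linarith) (by norm_num; linarith)
    rcases le_or_gt Δ ((139 : ℝ) / 32) with hd1 | hd1
    · exact cell_nonneg_of_bernAuto_trunc wtopeUA slL11_nodup slL11_deg 0 47 284 (q := 64) (a := 124) (L := 15) (by norm_num) (by norm_num) (by norm_num) (by rw [phatopeUAs0_eq]; exact cellChk_opeUA_s0l2) (by norm_num; linarith) (by norm_num; linarith)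
    rcases le_or_gt Δ ((77 : ℝ) / 16) with hd2 | hd2
    · exact cell_nonneg_of_bernAuto_trunc wtopeUA slL11_nodup slL11_deg 0 47 284 (q := 64) (a := 139) (L := 15) (by norm_num) (by norm_num) (by norm_num) (by rw [phatopeUAs0_eq]; exact cellChk_opeUA_s0l3) (by norm_num; linarith) (by norm_num; linarith)
    rcases le_or_gt Δ ((23 : ℝ) / 4) with hd3 | hd3
    · exact cell_nonneg_of_bernAuto_trunc wtopeUA slL11_nodup slL11_deg 0 47 284 (q := 32) (a := 77) (L := 15) (by norm_num) (by norm_num) (by norm_num) (by rw [phatopeUAs0_eq]; exact cellChk_opeUA_s0l4) (by norm_num; linarith) (by norm_num; linarith)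
    rcases le_or_gt Δ ((19 : ℝ) / 2) with hd4 | hd4
    · exact cell_nonneg_of_bernAuto_trunc wtopeUA slL11_nodup slL11_deg 0 47 284 (q := 8) (a := 23) (L := 15) (by norm_num) (by norm_num) (by norm_num) (by rw [phatopeUAs0_eq]; exact cellChk_opeUA_s0l5) (by norm_num; linarith) (by norm_num; linarith)
    rcases le_or_gt Δ (17 : ℝ) with hd5 | hd5
    · exact cell_nonneg_of_bernAuto_trunc wtopeUA slL11_nodup slL11_deg 0 47 284 (q := 4) (a := 19) (L := 15) (by norm_num) (by norm_num) (by norm_num) (by rw [phatopeUAs0_eq]; exact cellChk_opeUA_s0l6) (by norm_num; linarith) (by norm_num; linarith)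
    exact cell_nonneg_of_bernAuto_trunc wtopeUA slL11_nodup slL11_deg 0 47 284 (q := 2) (a := 17) (L := 15) (by norm_num) (by norm_num) (by norm_num) (by rw [phatopeUAs0_eq]; exact cellChk_opeUA_s0l7) (by norm_num; linarith) (by norm_num; linarith)
  · refine ⟨47 + 1, by norm_num, ?_⟩
    exact cell_nonneg_of_bernAuto_trunc wtopeUA slL11_nodup slL11_deg 2 47 290 (q := 1) (a := 0) (L := 0) (by norm_num) (by norm_num) (by norm_num) (by rw [phatopeUAs2_eq]; exact cellChk_opeUA_s2l0) (by norm_num) (by norm_num)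
  · intro Δ h1 h2
    replace h1 : (3 : ℝ) ≤ Δ := by linarith
    replace h2 := h2.le
    refine ⟨47 + 1, by norm_num, ?_⟩
    rcases le_or_gt Δ ((77 : ℝ) / 16) with hd0 | hd0
    · exact cell_nonneg_of_bernAuto_trunc wtopeUA slL11_nodup slL11_deg 2 47 290 (q := 32) (a := 16) (L := 29) (by norm_num) (by norm_num) (by norm_num) (by rw [phatopeUAs2_eq]; exact cellChk_opeUA_s2l1) (by norm_num; linarith) (by norm_num; linarith)
    rcases le_or_gt Δ ((183 : ℝ) / 32) with hd1 | hd1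
    · exact cell_nonneg_of_bernAuto_trunc wtopeUA slL11_nodup slL11_deg 2 47 290 (q := 64) (a := 90) (L := 29) (by norm_num) (by norm_num) (by norm_num) (by rw [phatopeUAs2_eq]; exact cellChk_opeUA_s2l2) (by norm_num; linarith) (by norm_num; linarith)
    rcases le_or_gt Δ ((53 : ℝ) / 8) with hd2 | hd2
    · exact cell_nonneg_of_bernAuto_trunc wtopeUA slL11_nodup slL11_deg 2 47 290 (q := 64) (a := 119) (L := 29) (by norm_num) (by norm_num) (by norm_num) (by rw [phatopeUAs2_eq]; exact cellChk_opeUA_s2l3) (by norm_num; linarith) (by norm_num; linarith)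
    rcases le_or_gt Δ ((41 : ℝ) / 4) with hd3 | hd3
    · exact cell_nonneg_of_bernAuto_trunc wtopeUA slL11_nodup slL11_deg 2 47 290 (q := 16) (a := 37) (L := 29) (by norm_num) (by norm_num) (by norm_num) (by rw [phatopeUAs2_eq]; exact cellChk_opeUA_s2l4) (by norm_num; linarith) (by norm_num; linarith)
    rcases le_or_gt Δ ((357 : ℝ) / 32) with hd4 | hd4
    · exact cell_nonneg_of_bernAuto_trunc wtopeUA slL11_nodup slL11_deg 2 47 290 (q := 64) (a := 264) (L := 29) (by norm_num) (by norm_num) (by norm_num) (by rw [phatopeUAs2_eq]; exact cellChk_opeUA_s2l5) (by norm_num; linarith) (by norm_num; linarith)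
    rcases le_or_gt Δ ((193 : ℝ) / 16) with hd5 | hd5
    · exact cell_nonneg_of_bernAuto_trunc wtopeUA slL11_nodup slL11_deg 2 47 290 (q := 64) (a := 293) (L := 29) (by norm_num) (by norm_num) (by norm_num) (by rw [phatopeUAs2_eq]; exact cellChk_opeUA_s2l6) (by norm_num; linarith) (by norm_num; linarith)
    rcases le_or_gt Δ ((111 : ℝ) / 8) with hd6 | hd6
    · exact cell_nonneg_of_bernAuto_trunc wtopeUA slL11_nodup slL11_deg 2 47 290 (q := 32) (a := 161) (L := 29) (by norm_num) (by norm_num) (by norm_num) (by rw [phatopeUAs2_eq]; exact cellChk_opeUA_s2l7) (by norm_num; linarith) (by norm_num; linarith)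
    rcases le_or_gt Δ ((35 : ℝ) / 2) with hd7 | hd7
    · exact cell_nonneg_of_bernAuto_trunc wtopeUA slL11_nodup slL11_deg 2 47 290 (q := 16) (a := 95) (L := 29) (by norm_num) (by norm_num) (by norm_num) (by rw [phatopeUAs2_eq]; exact cellChk_opeUA_s2l8) (by norm_num; linarith) (by norm_num; linarith)
    exact cell_nonneg_of_bernAuto_trunc wtopeUA slL11_nodup slL11_deg 2 47 290 (q := 4) (a := 31) (L := 29) (by norm_num) (by norm_num) (by norm_num) (by rw [phatopeUAs2_eq]; exact cellChk_opeUA_s2l9) (by norm_num; linarith) (by norm_num; linarith)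
  · intro ℓ hℓ hℓ0 hℓ2 Δ hℓΔ hΔ
    have hℓR : (ℓ : ℝ) < 32 := lt_of_le_of_lt hℓΔ hΔ
    have hℓE : ℓ < 32 := by exact_mod_cast hℓR
    replace h2 := hΔ.le
    interval_cases ℓ
    · exact absurd rfl hℓ0
    · exact absurd hℓ (by decide)
    · exact absurd rfl hℓ2
    · exact absurd hℓ (by decide)
    · have h1 : (4 : ℝ) ≤ Δ := by exact_mod_cast hℓΔ
      refine ⟨47 + 1, by norm_num, ?_⟩
      rcases le_or_gt Δ ((15 : ℝ) / 2) with hd0 | hd0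
      · exact cell_nonneg_of_bernAuto_trunc wtopeUA slL11_nodup slL11_deg 4 47 293 (q := 4) (a := 0) (L := 7) (by norm_num) (by norm_num) (by norm_num) (by rw [phatopeUAs4_eq]; exact cellChk_opeUA_s4l0) (by norm_num; linarith) (by norm_num; linarith)
      rcases le_or_gt Δ (11 : ℝ) with hd1 | hd1
      · exact cell_nonneg_of_bernAuto_trunc wtopeUA slL11_nodup slL11_deg 4 47 293 (q := 4) (a := 7) (L := 7) (by norm_num) (by norm_num) (by norm_num) (by rw [phatopeUAs4_eq]; exact cellChk_opeUA_s4l1) (by norm_num; linarith) (by norm_num; linarith)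
      rcases le_or_gt Δ (18 : ℝ) with hd2 | hd2
      · exact cell_nonneg_of_bernAuto_trunc wtopeUA slL11_nodup slL11_deg 4 47 293 (q := 2) (a := 7) (L := 7) (by norm_num) (by norm_num) (by norm_num) (by rw [phatopeUAs4_eq]; exact cellChk_opeUA_s4l2) (by norm_num; linarith) (by norm_num; linarith)
      exact cell_nonneg_of_bernAuto_trunc wtopeUA slL11_nodup slL11_deg 4 47 293 (q := 1) (a := 7) (L := 7) (by norm_num) (by norm_num) (by norm_num) (by rw [phatopeUAs4_eq]; exact cellChk_opeUA_s4l3) (by norm_num; linarith) (by norm_num; linarith)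
    · exact absurd hℓ (by decide)
    · have h1 : (6 : ℝ) ≤ Δ := by exact_mod_cast hℓΔ
      refine ⟨39 + 1, by norm_num, ?_⟩
      exact cell_nonneg_of_bernAuto_trunc wtopeUA slL11_nodup slL11_deg 6 39 240 (q := 1) (a := 0) (L := 13) (by norm_num) (by norm_num) (by norm_num) (by rw [phatopeUAs6_eq]; exact cellChk_opeUA_s6l0) (by norm_num; linarith) (by norm_num; linarith)
    · exact absurd hℓ (by decide)
    · have h1 : (8 : ℝ) ≤ Δ := by exact_mod_cast hℓΔ
      refine ⟨39 + 1, by norm_num, ?_⟩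
      rcases le_or_gt Δ ((35 : ℝ) / 4) with hd0 | hd0
      · exact cell_nonneg_of_bernAuto_trunc wtopeUA slL11_nodup slL11_deg 8 39 243 (q := 8) (a := 0) (L := 3) (by norm_num) (by norm_num) (by norm_num) (by rw [phatopeUAs8_eq]; exact cellChk_opeUA_s8l0) (by norm_num; linarith) (by norm_num; linarith)
      rcases le_or_gt Δ ((19 : ℝ) / 2) with hd1 | hd1
      · exact cell_nonneg_of_bernAuto_trunc wtopeUA slL11_nodup slL11_deg 8 39 243 (q := 8) (a := 3) (L := 3) (by norm_num) (by norm_num) (by norm_num) (by rw [phatopeUAs8_eq]; exact cellChk_opeUA_s8l1) (by norm_num; linarith) (by norm_num; linarith)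
      rcases le_or_gt Δ (11 : ℝ) with hd2 | hd2
      · exact cell_nonneg_of_bernAuto_trunc wtopeUA slL11_nodup slL11_deg 8 39 243 (q := 4) (a := 3) (L := 3) (by norm_num) (by norm_num) (by norm_num) (by rw [phatopeUAs8_eq]; exact cellChk_opeUA_s8l2) (by norm_num; linarith) (by norm_num; linarith)
      rcases le_or_gt Δ (14 : ℝ) with hd3 | hd3
      · exact cell_nonneg_of_bernAuto_trunc wtopeUA slL11_nodup slL11_deg 8 39 243 (q := 2) (a := 3) (L := 3) (by norm_num) (by norm_num) (by norm_num) (by rw [phatopeUAs8_eq]; exact cellChk_opeUA_s8l3) (by norm_num; linarith) (by norm_num; linarith)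
      rcases le_or_gt Δ (20 : ℝ) with hd4 | hd4
      · exact cell_nonneg_of_bernAuto_trunc wtopeUA slL11_nodup slL11_deg 8 39 243 (q := 1) (a := 3) (L := 3) (by norm_num) (by norm_num) (by norm_num) (by rw [phatopeUAs8_eq]; exact cellChk_opeUA_s8l4) (by norm_num; linarith) (by norm_num; linarith)
      exact cell_nonneg_of_bernAuto_trunc wtopeUA slL11_nodup slL11_deg 8 39 243 (q := 1) (a := 6) (L := 6) (by norm_num) (by norm_num) (by norm_num) (by rw [phatopeUAs8_eq]; exact cellChk_opeUA_s8l5) (by norm_num; linarith) (by norm_num; linarith)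
    · exact absurd hℓ (by decide)
    · have h1 : (10 : ℝ) ≤ Δ := by exact_mod_cast hℓΔ
      refine ⟨39 + 1, by norm_num, ?_⟩
      exact cell_nonneg_of_bernAuto_trunc wtopeUA slL11_nodup slL11_deg 10 39 247 (q := 1) (a := 0) (L := 11) (by norm_num) (by norm_num) (by norm_num) (by rw [phatopeUAs10_eq]; exact cellChk_opeUA_s10l0) (by norm_num; linarith) (by norm_num; linarith)
    · exact absurd hℓ (by decide)
    · have h1 : (12 : ℝ) ≤ Δ := by exact_mod_cast hℓΔ
      refine ⟨39 + 1, by norm_num, ?_⟩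
      exact cell_nonneg_of_bernAuto_trunc wtopeUA slL11_nodup slL11_deg 12 39 250 (q := 1) (a := 0) (L := 10) (by norm_num) (by norm_num) (by norm_num) (by rw [phatopeUAs12_eq]; exact cellChk_opeUA_s12l0) (by norm_num; linarith) (by norm_num; linarith)
    · exact absurd hℓ (by decide)
    · have h1 : (14 : ℝ) ≤ Δ := by exact_mod_cast hℓΔ
      refine ⟨31 + 1, by norm_num, ?_⟩
      exact cell_nonneg_of_bernAuto_trunc wtopeUA slL11_nodup slL11_deg 14 31 196 (q := 1) (a := 0) (L := 9) (by norm_num) (by norm_num) (by norm_num) (by rw [phatopeUAs14_eq]; exact cellChk_opeUA_s14l0) (by norm_num; linarith) (by norm_num; linarith)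
    · exact absurd hℓ (by decide)
    · have h1 : (16 : ℝ) ≤ Δ := by exact_mod_cast hℓΔ
      refine ⟨31 + 1, by norm_num, ?_⟩
      exact cell_nonneg_of_bernAuto_trunc wtopeUA slL11_nodup slL11_deg 16 31 198 (q := 1) (a := 0) (L := 8) (by norm_num) (by norm_num) (by norm_num) (by rw [phatopeUAs16_eq]; exact cellChk_opeUA_s16l0) (by norm_num; linarith) (by norm_num; linarith)
    · exact absurd hℓ (by decide)
    · have h1 : (18 : ℝ) ≤ Δ := by exact_mod_cast hℓΔ
      refine ⟨31 + 1, by norm_num, ?_⟩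
      exact cell_nonneg_of_bernAuto_trunc wtopeUA slL11_nodup slL11_deg 18 31 200 (q := 1) (a := 0) (L := 7) (by norm_num) (by norm_num) (by norm_num) (by rw [phatopeUAs18_eq]; exact cellChk_opeUA_s18l0) (by norm_num; linarith) (by norm_num; linarith)
    · exact absurd hℓ (by decide)
    · have h1 : (20 : ℝ) ≤ Δ := by exact_mod_cast hℓΔ
      refine ⟨31 + 1, by norm_num, ?_⟩
      exact cell_nonneg_of_bernAuto_trunc wtopeUA slL11_nodup slL11_deg 20 31 202 (q := 1) (a := 0) (L := 6) (by norm_num) (by norm_num) (by norm_num) (by rw [phatopeUAs20_eq]; exact cellChk_opeUA_s20l0) (by norm_num; linarith) (by norm_num; linarith)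
    · exact absurd hℓ (by decide)
    · have h1 : (22 : ℝ) ≤ Δ := by exact_mod_cast hℓΔ
      refine ⟨31 + 1, by norm_num, ?_⟩
      exact cell_nonneg_of_bernAuto_trunc wtopeUA slL11_nodup slL11_deg 22 31 203 (q := 1) (a := 0) (L := 5) (by norm_num) (by norm_num) (by norm_num) (by rw [phatopeUAs22_eq]; exact cellChk_opeUA_s22l0) (by norm_num; linarith) (by norm_num; linarith)
    · exact absurd hℓ (by decide)
    · have h1 : (24 : ℝ) ≤ Δ := by exact_mod_cast hℓΔ
      refine ⟨31 + 1, by norm_num, ?_⟩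
      exact cell_nonneg_of_bernAuto_trunc wtopeUA slL11_nodup slL11_deg 24 31 205 (q := 1) (a := 0) (L := 4) (by norm_num) (by norm_num) (by norm_num) (by rw [phatopeUAs24_eq]; exact cellChk_opeUA_s24l0) (by norm_num; linarith) (by norm_num; linarith)
    · exact absurd hℓ (by decide)
    · have h1 : (26 : ℝ) ≤ Δ := by exact_mod_cast hℓΔ
      refine ⟨31 + 1, by norm_num, ?_⟩
      exact cell_nonneg_of_bernAuto_trunc wtopeUA slL11_nodup slL11_deg 26 31 206 (q := 1) (a := 0) (L := 3) (by norm_num) (by norm_num) (by norm_num) (by rw [phatopeUAs26_eq]; exact cellChk_opeUA_s26l0) (by norm_num; linarith) (by norm_num; linarith)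
    · exact absurd hℓ (by decide)
    · have h1 : (28 : ℝ) ≤ Δ := by exact_mod_cast hℓΔ
      refine ⟨31 + 1, by norm_num, ?_⟩
      exact cell_nonneg_of_bernAuto_trunc wtopeUA slL11_nodup slL11_deg 28 31 208 (q := 1) (a := 0) (L := 2) (by norm_num) (by norm_num) (by norm_num) (by rw [phatopeUAs28_eq]; exact cellChk_opeUA_s28l0) (by norm_num; linarith) (by norm_num; linarith)
    · exact absurd hℓ (by decide)
    · have h1 : (30 : ℝ) ≤ Δ := by exact_mod_cast hℓΔ
      refine ⟨31 + 1, by norm_num, ?_⟩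
      exact cell_nonneg_of_bernAuto_trunc wtopeUA slL11_nodup slL11_deg 30 31 209 (q := 1) (a := 0) (L := 1) (by norm_num) (by norm_num) (by norm_num) (by rw [phatopeUAs30_eq]; exact cellChk_opeUA_s30l0) (by norm_num; linarith) (by norm_num; linarith)
    · exact absurd hℓ (by decide)

/-- **2D control, γ-architecture, kind `ope2` (upper sense), kernel-complete: under `A2D′` at `Δ_σ = 1/8` with the `ε` box
`[49/50, 20001/20000]`, `p_T < 156383/10000000`**, every obligation of the Λ = 11 functional checked in the Lean kernel. CONTROL-ONLY (d = 2).
[cite: RattazziEtAl2008, §5.5] -/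
theorem opeUpper_2d_L11_opeUA : OpeUpperA2D (1 / 8 : ℝ) 2 1 (49 / 50) (20001 / 20000) (156383 / 10000000) := by
  have h := opeUpper_half_of_cellsZ wtopeUA slL11_nodup slL11_deg (G := 2) (δ := 1) (e₁ := 49 / 50) (e₂ := 20001 / 20000)
    (E₀ := 32) (Pn := 156383) (Pd := 10000000) (Nd := 47) (by norm_num) (by norm_num) (by norm_num) (by norm_num)
    (by norm_num) (by norm_num) (by rw [phatopeUAs2_eq]; decide +kernel) (by rw [phatopeUAs2_eq]; decide +kernel)
    (fun b J hb hE => region_opeUA b J hb hE) cells_opeUA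
  push_cast at h
  exact h

/-- **The `c` lower edge this certificate puts on the kernel** (by the Virasoro Ward identity `p_T = Δ_σ²/(2c)`, taken as a
HYPOTHESIS on the datum exactly as in `cTwoSided_rb6_L11`): every parity-symmetric unitary solution of the 2D sum rule at `Δ_σ = 1/8`
under `A2D′` with the `ε` box `[49/50, 20001/20000]` whose total `(2,2)` coefficient equals `(1/8)²/(2c)` with `c > 0` has
`(1/8)²/(2·(156383/10000000)) < c`, i.e. `c > 78125/156383 ≈ 0.4995748`. CONTROL-ONLY (d = 2). [cite: RattazziEtAl2008, §5] -/
theorem cLower_2d_L11_opeUA {D : CrossingData} (hU : D.IsUnitary) (hC : D.SatisfiesCrossing (1 / 8))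
    (hS : D.ScalarsIn (Icc (49 / 50 : ℝ) (20001 / 20000) ∪ Ici 2)) (hT2 : D.SpinTwoIn ({2} ∪ Ici (2 + 1)))
    {c : ℝ} (hc : 0 < c) (hWard : D.stressCoeff = (1 / 8 : ℝ) ^ 2 / (2 * c)) :
    (1 / 8 : ℝ) ^ 2 / (2 * (156383 / 10000000)) < c :=
  centralCharge_lower_bound hc hWard (opeUpper_2d_L11_opeUA D hU hC hS hT2)

end Summit.CriticalPhenomena.Ising3D.Control2D
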